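import Summits.QuantumFields.BalabanUV.Beta.CombHId2Words
import Summits.QuantumFields.BalabanUV.Beta.SpineRecursiveW

/-!
# `BalabanUV.Beta.CombHId2Periodised` — binder row D1 (OWNER an2), (J-a) dictionary, (C2) at ORDER 2, part TWO-b (assembly): **THE SECOND BOND-DERIVATIVE OF
# THE INVERSE, COPY-SUMMED IN THE SECOND BOND AND PERIODISED, IS THE SAME WORD OVER THE PERIODISED TABLES** —
# `dper M′ (x z ↦ Σ'_n e4OfKW N K S Mt W b (b′ + M′∘n) x z) = e4OfKW N K S^per Mt^per W^{per,cs} b b′` (`M = N·M′`),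
# `S^per κ u := dper M (S κ u)`, `Mt^per ρ w := dper M (Mt ρ w)`, `W^{per,cs} b b′ := dper M (x z ↦ Σ'_n W b (b′ + M′∘n) x z)`

WHY.  The level-`(j+1)` second-order table is `T2RecOf … (j+1) = (cE₂·wV4 (j+1)) • e4OfKW Lc (G j) (S j) (M j) (WrecOf … j) + (cB·wB2 (j+1)) • vh₂S`
(`RecursiveWSlot.T2RecOf_succ`), `e4OfKW Lc K S Mt W b b′ = mmRead Lc (K3OfK K Lc S Mt W b b′)`.  The door binds a two-bond table on the torus with the SECOND
bond's period copies summed pointwise and then periodised (U21's `hW₂₂` shape).  With the three copy-summed words of `CombHId2Words`, `dper` passes every factor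
(gan24-p3's bimodule rules `comp_dper_left ∕ _right`, C2b's `dper_sandwich`, C3a's `dper_dM ∕ dper_K2OfK`), and the `mm`-read commutes with periodisation.  The
`W` slot comes out in the SAME copy-sum-then-periodise shape one level down — the dictionary recurses in `j`.
WHAT ([folklore]; 0 `def`, 0 cited fact, 0 `def … : Prop`, 0 sorry): §2 **`tsum_K3OfK_translate`** (the copy-summed `K3OfK`, pointwise), **`dper_tsum_K3OfK_translate`**
(kernel identity `dper M (x z ↦ Σ'_n K3OfK … b (b′+M′∘n) x z) = K3OfK K N S^per Mt^per W^{per,cs} b b′`); §3 `dper_mmRead`, `tsum_mmRead_apply`,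
**`dper_tsum_e4OfKW_translate`** (the headline).  Hypotheses as in `CombHId2Words`.
NOT HERE: the door's `hId₂` (part THREE: leaf-05 g29's `torus_hId₂_iff_graded_comb` polynomial matched with these words' `perF`s); nothing of Bałaban's asserted;
`D1Tel` ∕ `D1Rep` OPEN; NOT (T-ID), NOT D1, NEVER «G-an2-4 closed», NOT BetaPertH, NOT continuum, NOT Clay.

HONEST DEPENDENCY (page 1, mandatory): continuum YM on T⁴ ⇐ BetaPertH ∧ nine spine estimates (0/9 proved); BetaPertH ⇐ (D1) ∧ (D4) ∧ CAP+tail;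
G-an2-4 gates asym, D1 and NE2/3/4.  HONEST FRAMING (cell contract, verbatim): «discharging `BetaPertH` makes Bałaban's UV stability UNCONDITIONAL —
a real constructive-QFT result; it is NOT the continuum limit and NOT the Clay problem.»  ABSOLUTE RULE (cell charter, verbatim): «No internally-minted
statement may enter as a cited fact. Every hypothesis is either kernel-proved in this package or a verbatim quotation of a PUBLISHED theorem with page
reference. The manuscript(s) under audit are NOT citable for their own disputed steps — they are the thing under adjudication; programme-internal
(2001/route/tribunal) claims are never citable.»  Row D1 OWNER an2 (b2b-balaban-beta-an2) gen 44, 2026-08-23; over C2b∕C3a∕C3c∕`CombHId2Words` BY NAME.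
-/

noncomputable section

open scoped BigOperators

namespace Summit.QuantumFields.BalabanUV.Beta.CombHId2Periodised

open Literature.MathematicalPhysics.QuantumFieldTheory.Balaban1983to89
open Literature.MathematicalPhysics.QuantumFieldTheory.Balaban1983to89.Beta
open B12Sec2to5 (l1 l1_nonneg)
open B4TorusKernel.MultiPeriod (translate translate_apply)
open B4Reflection242 (translate_translate)
open B4Sect5Proof (latticeConst latticeConst_nonneg)
open ExpKernelCalculus (MKer Decays BiLoc VertexFamily comp shiftK comp_shiftK Zl Zl_nonneg l1_sub_symm)
open AffineAveraging (Site)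
open OneStepResolventKernel (Fib LocStencil decays_mono biLoc_mono)
open SecondOrderResponse (dM K2OfK vertexFamily_dM vertexFamily_K2OfK cdM_nonneg cK2_nonneg)
open BalabanStepJetsSucc (mmRead mmRead_inl_inl mmRead_inr_left mmRead_inr_right biLoc_comp_right)
open BalabanStepW2 (K3OfK vertexFamily_mono')
open BalabanStepJets (locStencil_mono)
open Summit.QuantumFields.BalabanUV.Beta.SpineRooted (e4OfKW)
open Summit.QuantumFields.BalabanUV.Beta.FP.KernelPeriodisationFibLoc (dper dper_apply dper_translate summable_dper decays_dper_diag comp_dper_left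
  comp_dper_right comp_dper_apply_eq_tsum dper_comp_apply_eq_tsum decays_of_biLoc shiftK_eq_translate summable_exp_l1_translate)
open Summit.QuantumFields.BalabanUV.Beta.CombHId1Letters (nsmul_translate)
open Summit.QuantumFields.BalabanUV.Beta.CombHId1Sandwich (dper_sandwich shiftK_of_translate_inv)
open Summit.QuantumFields.BalabanUV.Beta.CombHId2Letters (dper_dM dper_K2OfK)
open Summit.QuantumFields.BalabanUV.Beta.CombHId2CopySum (biLoc_tsum_family tsum_sandwich_family dper_shiftK_per comp_shiftK_of_inv
  dM_translate_per K2OfK_translate_per)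

open Summit.QuantumFields.BalabanUV.Beta.CombHId2Words (exists_biLoc_comp_left exists_biLoc_comp_right exists_biLoc_sandwich exists_decays_of_biLoc
  dper_neg_sub_sub exists_biLoc_dM_K2OfK tsum_word₁ tsum_word₂ tsum_word₃ W_family summable_words)

variable {d : ℕ} (M : Fin (d + 1) → ℕ) [∀ μ, NeZero (M μ)]

/-! ## §2 `K3OfK` copy-summed in the second bond, then periodised -/

section K3

variable {N : ℕ} [NeZero N] {M' : Fin (d + 1) → ℕ} {K : MKer (d + 1) (Fib d)} {CK δK CS δS CM δM Cw δw : ℝ}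
  {S Mt : Fin (d + 1) → Site (d + 1) → MKer (d + 1) (Fib d)}
  {W : Fin (d + 1) → Site (d + 1) → Fin (d + 1) → Site (d + 1) → MKer (d + 1) (Fib d)}

/-- [folklore] **THE COPY-SUMMED `K3OfK`** (pointwise): `Σ'_n K3OfK K N S Mt W b (b′+M′∘n) x z a b =
−((K·dM_b)·dper(K2_{b′})) x z a b − (dper(K·dM_{b′})·K2_b) x z a b − (K·(x z ↦ Σ'_n W_{b,b′+M′∘n} x z)·K) x z a b`. -/
theorem tsum_K3OfK_translate (hM : ∀ i, M i = N * M' i)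
    (hKinv : ∀ (m x z : Site (d + 1)) (a b : Fib d), K (translate M x m) (translate M z m) a b = K x z a b)
    (hK : Decays K CK δK) (hδK : 0 < δK)
    (hSt : ∀ (κ : Fin (d + 1)) (u m x z : Site (d + 1)) (a b : Fib d), S κ (translate M u m) (translate M x m) (translate M z m) a b = S κ u x z a b)
    (hS : ∀ κ u, BiLoc (S κ u) u u CS δS) (hδS : 0 < δS)
    (hMt : ∀ (ρ : Fin (d + 1)) (w m x z : Site (d + 1)) (a b : Fib d), Mt ρ (translate M' w m) (translate M x m) (translate M z m) a b = Mt ρ w x z a b)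
    (hMloc : VertexFamily Mt N CM δM) (hδM : 0 < δM)
    (hW : ∀ μ y ν y', BiLoc (W μ y ν y') ((N : ℤ) • y) ((N : ℤ) • y) (Cw * Real.exp (-δw * l1 ((N : ℤ) • y' - (N : ℤ) • y))) δw)
    (hδw : 0 < δw) (μ : Fin (d + 1)) (y : Site (d + 1)) (ν : Fin (d + 1)) (y' : Site (d + 1)) (x z : Site (d + 1)) (a b : Fib d) :
    ∑' n, K3OfK K N S Mt W μ y ν (translate M' y' n) x z a b
      = -(comp (comp K (dM K N S Mt μ y)) (dper M (K2OfK K N S Mt ν y')) x z a b)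
        - comp (dper M (comp K (dM K N S Mt ν y'))) (K2OfK K N S Mt μ y) x z a b
        - comp (comp K (fun x z a b => ∑' n, W μ y ν (translate M' y' n) x z a b)) K x z a b := by
  obtain ⟨s₁, s₂, s₃⟩ := summable_words M hM hKinv hK hδK hSt hS hδS hMt hMloc hδM hW hδw μ y ν y' x z a b
  rw [← tsum_word₁ M hM hKinv hK hδK hSt hS hδS hMt hMloc hδM μ y ν y' x z a b,
    ← tsum_word₂ M hM hKinv hK hδK hSt hS hδS hMt hMloc hδM μ y ν y' x z a b, ← tsum_word₃ M hM hK hδK hW hδw μ y ν y' x z a b,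
    ← tsum_neg, ← s₁.neg.tsum_sub s₂, ← (s₁.neg.sub s₂).tsum_sub s₃]
  exact tsum_congr fun n => rfl

/-- [folklore] **`dper` OF THE COPY-SUMMED `K3OfK` IS `K3OfK` OVER THE PERIODISED TABLES**:
`dper M (x z ↦ Σ'_n K3OfK K N S Mt W b (b′+M′∘n) x z) = K3OfK K N S^per Mt^per W^{per,cs} b b′`. -/
theorem dper_tsum_K3OfK_translate (hM : ∀ i, M i = N * M' i)
    (hKinv : ∀ (m x z : Site (d + 1)) (a b : Fib d), K (translate M x m) (translate M z m) a b = K x z a b)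
    (hK : Decays K CK δK) (hCK : 0 ≤ CK) (hδK : 0 < δK)
    (hSt : ∀ (κ : Fin (d + 1)) (u m x z : Site (d + 1)) (a b : Fib d), S κ (translate M u m) (translate M x m) (translate M z m) a b = S κ u x z a b)
    (hS : ∀ κ u, BiLoc (S κ u) u u CS δS) (hδS : 0 < δS)
    (hMt : ∀ (ρ : Fin (d + 1)) (w m x z : Site (d + 1)) (a b : Fib d), Mt ρ (translate M' w m) (translate M x m) (translate M z m) a b = Mt ρ w x z a b)
    (hMloc : VertexFamily Mt N CM δM) (hδM : 0 < δM)
    (hW : ∀ μ y ν y', BiLoc (W μ y ν y') ((N : ℤ) • y) ((N : ℤ) • y) (Cw * Real.exp (-δw * l1 ((N : ℤ) • y' - (N : ℤ) • y))) δw)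
    (hδw : 0 < δw) (μ : Fin (d + 1)) (y : Site (d + 1)) (ν : Fin (d + 1)) (y' : Site (d + 1)) :
    dper M (fun x z a b => ∑' n, K3OfK K N S Mt W μ y ν (translate M' y' n) x z a b)
      = K3OfK K N (fun κ u => dper M (S κ u)) (fun ρ w => dper M (Mt ρ w))
          (fun μ y ν y' => dper M (fun x z a b => ∑' n, W μ y ν (translate M' y' n) x z a b)) μ y ν y' := by
  obtain ⟨C₀, δ₀, hδ₀, hdM, hK2⟩ := exists_biLoc_dM_K2OfK hK hδK hS hδS hMloc hδM
  have hC₀ : 0 ≤ C₀ := (hdM 0 0).nonneg (Sum.inl 0)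
  obtain ⟨hT, hg, hg0⟩ := W_family M hM hW hδw μ y ν y'
  -- the letters: `B := K·dM_b`, `V := K2_{b′}`, `B′ := K·dM_{b′}`, `V′ := K2_b`, the copy-summed `W`
  obtain ⟨CB, δB, hδB, hB⟩ := exists_biLoc_comp_left hK hδK (hdM μ y) hδ₀
  obtain ⟨CB', δB', hδB', hB'⟩ := exists_biLoc_comp_left hK hδK (hdM ν y') hδ₀
  have hVd := decays_dper_diag M (hK2 ν y') hC₀ hδ₀
  have hVinv : ∀ (m x z : Site (d + 1)) (a b : Fib d), dper M (K2OfK K N S Mt ν y') (translate M x m) (translate M z m) a b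
      = dper M (K2OfK K N S Mt ν y') x z a b := fun m x z a b => dper_translate M _ m x z a b
  have hB'd := decays_dper_diag M hB' (hB'.nonneg (Sum.inl 0)) hδB'
  have hB'inv : ∀ (m x z : Site (d + 1)) (a b : Fib d), dper M (comp K (dM K N S Mt ν y')) (translate M x m) (translate M z m) a b
      = dper M (comp K (dM K N S Mt ν y')) x z a b := fun m x z a b => dper_translate M _ m x z a b
  have hWcs := biLoc_tsum_family (T := fun n => W μ y ν (translate M' y' n)) hT hg
  -- step 1: the copy sum, pointwise
  have h1 : (fun x z a b => ∑' n, K3OfK K N S Mt W μ y ν (translate M' y' n) x z a b)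
      = fun x z a b => -(comp (comp K (dM K N S Mt μ y)) (dper M (K2OfK K N S Mt ν y')) x z a b)
          - comp (dper M (comp K (dM K N S Mt ν y'))) (K2OfK K N S Mt μ y) x z a b
          - comp (comp K (fun x z a b => ∑' n, W μ y ν (translate M' y' n) x z a b)) K x z a b := by
    funext x z a b
    exact tsum_K3OfK_translate M hM hKinv hK hδK hSt hS hδS hMt hMloc hδM hW hδw μ y ν y' x z a b
  -- step 2: `dper` term by term
  rw [h1, dper_neg_sub_sub M ⟨_, _, _, _, (exists_biLoc_comp_right hB hδB hVd (half_pos hδ₀)).choose_spec.choose_spec⟩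
    ⟨_, _, _, _, (exists_biLoc_comp_left hB'd (half_pos hδB') (hK2 μ y) hδ₀).choose_spec.choose_spec⟩
    ⟨_, _, _, _, (exists_biLoc_sandwich hK hδK hWcs hδw).choose_spec.choose_spec⟩]
  -- step 3: the three periodised words
  have e1 : dper M (comp (comp K (dM K N S Mt μ y)) (dper M (K2OfK K N S Mt ν y')))
      = comp (comp K (dM K N (fun κ u => dper M (S κ u)) (fun ρ w => dper M (Mt ρ w)) μ y))
          (K2OfK K N (fun κ u => dper M (S κ u)) (fun ρ w => dper M (Mt ρ w)) ν y') := by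
    rw [← comp_dper_right M hB hδB hVd (half_pos hδ₀) hVinv, ← comp_dper_left M hK hδK hKinv (hdM μ y) hδ₀,
      dper_dM M K S Mt hM hKinv hK hCK hδK hSt hS hδS hMt hMloc hδM μ y, dper_K2OfK M K S Mt hM hKinv hK hCK hδK hSt hS hδS hMt hMloc hδM ν y']
  have e2 : dper M (comp (dper M (comp K (dM K N S Mt ν y'))) (K2OfK K N S Mt μ y))
      = comp (comp K (dM K N (fun κ u => dper M (S κ u)) (fun ρ w => dper M (Mt ρ w)) ν y'))
          (K2OfK K N (fun κ u => dper M (S κ u)) (fun ρ w => dper M (Mt ρ w)) μ y) := by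
    rw [← comp_dper_left M hB'd (half_pos hδB') hB'inv (hK2 μ y) hδ₀, ← comp_dper_left M hK hδK hKinv (hdM ν y') hδ₀,
      dper_dM M K S Mt hM hKinv hK hCK hδK hSt hS hδS hMt hMloc hδM ν y', dper_K2OfK M K S Mt hM hKinv hK hCK hδK hSt hS hδS hMt hMloc hδM μ y]
  have e3 : dper M (comp (comp K (fun x z a b => ∑' n, W μ y ν (translate M' y' n) x z a b)) K)
      = comp (comp K (dper M (fun x z a b => ∑' n, W μ y ν (translate M' y' n) x z a b))) K :=
    dper_sandwich M hKinv hK hδK hWcs hδw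
  rw [e1, e2, e3]
  rfl

end K3

/-! ## §3 The `mm`-read and the headline: `e4OfKW` copy-summed and periodised -/

section E4

variable {N : ℕ} [NeZero N] {M' : Fin (d + 1) → ℕ}

omit [∀ μ, NeZero (M μ)] [NeZero N] in
/-- [folklore] **THE `mm`-READ COMMUTES WITH PERIODISATION** (`M = N·M′`): `dper M′ (mmRead N F) = mmRead N (dper M F)` (pure re-indexing: `N•(x′+M′∘m) = N•x′ + M∘m`). -/
theorem dper_mmRead (hM : ∀ i, M i = N * M' i) (F : MKer (d + 1) (Fib d)) : dper M' (mmRead N F) = mmRead N (dper M F) := by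
  funext x' z' a b
  rcases a with α | α <;> rcases b with β | β
  · simp only [dper_apply, mmRead_inl_inl, nsmul_translate hM]
  · simp only [dper_apply, mmRead_inr_right, tsum_zero]
  · simp only [dper_apply, mmRead_inr_left, tsum_zero]
  · simp only [dper_apply, mmRead_inr_left, tsum_zero]

omit [∀ μ, NeZero (M μ)] [NeZero N] in
/-- [folklore] the `mm`-read commutes with a pointwise sum over a family (entrywise re-indexing; the off-blocks are `Σ' 0 = 0`). -/
theorem tsum_mmRead_apply (F : Site (d + 1) → MKer (d + 1) (Fib d)) (x' z' : Site (d + 1)) (a b : Fib d) :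
    ∑' n, mmRead N (F n) x' z' a b = mmRead N (fun x z a b => ∑' n, F n x z a b) x' z' a b := by
  rcases a with α | α <;> rcases b with β | β
  · simp only [mmRead_inl_inl]
  · simp only [mmRead_inr_right, tsum_zero]
  · simp only [mmRead_inr_left, tsum_zero]
  · simp only [mmRead_inr_left, tsum_zero]

variable {K : MKer (d + 1) (Fib d)} {CK δK CS δS CM δM Cw δw : ℝ} {S Mt : Fin (d + 1) → Site (d + 1) → MKer (d + 1) (Fib d)}
  {W : Fin (d + 1) → Site (d + 1) → Fin (d + 1) → Site (d + 1) → MKer (d + 1) (Fib d)}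

/-- [folklore] **THE HEADLINE — `e4OfKW` COPY-SUMMED IN THE SECOND BOND AND PERIODISED IS `e4OfKW` OVER THE PERIODISED TABLES** (`M = N·M′`; `K` fine-period
invariant and decaying; `S` fine-bond tables period covariant and bond-localised; `Mt` coarse-bond tables `M′`-period covariant and localised at the coarse bond;
`W` far-small at its first bond):
`dper M′ (x z ↦ Σ'_n e4OfKW N K S Mt W b (b′ + M′∘n) x z) = e4OfKW N K S^per Mt^per W^{per,cs} b b′`, `W^{per,cs} b b′ := dper M (x z ↦ Σ'_n W b (b′+M′∘n) x z)` —
the `W` slot returns in the SAME copy-sum-then-periodise shape one level down. -/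
theorem dper_tsum_e4OfKW_translate (hM : ∀ i, M i = N * M' i)
    (hKinv : ∀ (m x z : Site (d + 1)) (a b : Fib d), K (translate M x m) (translate M z m) a b = K x z a b)
    (hK : Decays K CK δK) (hCK : 0 ≤ CK) (hδK : 0 < δK)
    (hSt : ∀ (κ : Fin (d + 1)) (u m x z : Site (d + 1)) (a b : Fib d), S κ (translate M u m) (translate M x m) (translate M z m) a b = S κ u x z a b)
    (hS : ∀ κ u, BiLoc (S κ u) u u CS δS) (hδS : 0 < δS)
    (hMt : ∀ (ρ : Fin (d + 1)) (w m x z : Site (d + 1)) (a b : Fib d), Mt ρ (translate M' w m) (translate M x m) (translate M z m) a b = Mt ρ w x z a b)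
    (hMloc : VertexFamily Mt N CM δM) (hδM : 0 < δM)
    (hW : ∀ μ y ν y', BiLoc (W μ y ν y') ((N : ℤ) • y) ((N : ℤ) • y) (Cw * Real.exp (-δw * l1 ((N : ℤ) • y' - (N : ℤ) • y))) δw)
    (hδw : 0 < δw) (μ : Fin (d + 1)) (y : Site (d + 1)) (ν : Fin (d + 1)) (y' : Site (d + 1)) :
    dper M' (fun x z a b => ∑' n, e4OfKW N K S Mt W μ y ν (translate M' y' n) x z a b)
      = e4OfKW N K (fun κ u => dper M (S κ u)) (fun ρ w => dper M (Mt ρ w))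
          (fun μ y ν y' => dper M (fun x z a b => ∑' n, W μ y ν (translate M' y' n) x z a b)) μ y ν y' := by
  have h1 : (fun x z a b => ∑' n, e4OfKW N K S Mt W μ y ν (translate M' y' n) x z a b)
      = mmRead N (fun x z a b => ∑' n, K3OfK K N S Mt W μ y ν (translate M' y' n) x z a b) := by
    funext x' z' a b
    exact tsum_mmRead_apply (fun n => K3OfK K N S Mt W μ y ν (translate M' y' n)) x' z' a b
  rw [h1, dper_mmRead M hM, dper_tsum_K3OfK_translate M hM hKinv hK hCK hδK hSt hS hδS hMt hMloc hδM hW hδw μ y ν y']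
  rfl

end E4

end Summit.QuantumFields.BalabanUV.Beta.CombHId2Periodised

end
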